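import Mathlib
import Literature.Analysis.UnboundedOperators.HeatExtensionLogGradient
import Literature.Analysis.FluidPDE.ClassicalOvershootBound
import Literature.Analysis.FluidPDE.OseenDuhamelDifferentiation
import Summits.NavierStokesRegularity.NavierStokesRegularity.Theorems.LevelSetModerationHighSpeedPressureWorkEarlyGradient

/-!
# Route LevelSetModeration — `HighSpeedPressureWork`: fast-set gradient bricks (frozen direction, Duhamel gradient)

Support file for item stmt-NavierStokesRegularity-18149 (`HighSpeedPressureWork`), line
`iso-speed-area-closure`, stub `stub_earlyBookkeeping` (the margin-zero early law, the only debt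
of the crux that is not the class-uniform speed bound, `…CruxAnatomy.lean`). The early stub lives
at levels `c ↓ sup|u₀| = B₀` and times `τ ↓ 0`, where the rigorous class-uniform gradient rate is
parabolic, `‖∇u(τ)‖ ≤ C B₀/√(ντ)` (`earlyBookkeeping_norm_fderiv_le`, p165554). This file proves
that ON THE FAST SET `{|u(τ)| > B₀}` the gradient of the SPEED is logarithmic instead:

  `‖∇|u|(τ, x)‖ ≤ A (B₀²/ν) √(1 + log(ν/(B₀² τ)))`  whenever `‖u(τ,x)‖ > B₀`, `0 < τ ≤ ε ν/B₀²`

(`levelSetModeration_fastSetGradient`; unit form `levelSetModeration_fastSetGradient_unit`,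
scale-invariant form under a speed bound `levelSetModeration_fastSetGradient_of_speed_le`).

Mechanism (all bricks landed): the mild formula from `s = τ/2`
(`mild_of_bounded_of_eLpNorm_two_le_of_lt`), `u(τ) = e^{(τ-s)Δ}u(s) − B_s(u,u)(τ)`; at a fast point
`x` freeze the unit vector `e = u(τ,x)/|u(τ,x)|`, so that `∇|u|(τ,·)(x) = e·∇u(τ,x)` (Fermat:
`|u| − e·u ≥ 0` vanishes at `x`). The caloric part `e·e^{(τ-s)Δ}u(s) = B_s' − e^{(τ-s)Δ}g`,
`g = B_s' − e·u(s) ∈ [0, 2B_s']`, `B_s' = B₀ + C√(s)` the overshoot bound at time `s`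
(`exists_norm_le_initial_add_of_classical_unit`), has at `x` the small value
`e^{(τ-s)Δ}g(x) ≤ (B_s' − B₀) + ‖B_s(u,u)(τ,x)‖ ≲ √τ` (fastness + `exists_norm_oseenDuhamel_le_mul`),
so HAMILTON's logarithmic gradient estimate (`norm_fderiv_heatExtension_le_mul_sqrt_log`,
p166134) bounds `‖∇e^{(τ-s)Δ}g(x)‖ ≲ √τ · √(log(1/τ)/τ) = √(log(1/τ))`; the Duhamel part has a
bounded gradient, `‖∇B_s(u,u)(τ)‖ ≲ ∫ₛ^τ (τ−σ)^{-1/2} ‖∇u(σ)‖ dσ ≲ 1`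
(`norm_fderiv_oseenDuhamel_le`, `fderiv_oseenSlice_apply_of_contDiff`, the early gradient rate).
This improves the rigorous ceiling on fast-set speed gradients at margin zero from `τ^{-1/4}`
(Li–Yau/Bernstein flatness) to `√(log(1/τ))`.

This first file holds the two calculus lemmas and the bounded Duhamel gradient
(`levelSetModeration_norm_fderiv_oseenDuhamel_le_unit`); the unit form of the fast-set bound is in
`…FastSetGradientUnit.lean`, the scale-invariant and class forms in `…FastSetGradient.lean`.
-/

noncomputable section

-- single-conjunct summit: `Summit.<Summit>.<Problem>` repeats the name by the D-0017 layout
set_option linter.dupNamespace false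

namespace Summit.NavierStokesRegularity.NavierStokesRegularity.Theorems

open MeasureTheory Set Filter Topology Function
open scoped ENNReal RealInnerProductSpace
open Literature.Analysis.FluidPDE
open Literature.Analysis.UnboundedOperators (heatExtension heatKernel heatExtension_apply
  heatKernel_pos integrable_heatKernel_holds integral_heatKernel_eq_one_holds
  integrable_heatKernel_smul_of_bound norm_fderiv_heatExtension_le_mul_sqrt_log
  contDiff_heatExtension_holds memLp_top_of_continuous_of_bound)

/-! ### Two calculus lemmas -/

/-- **The gradient of the speed is the frozen-direction derivative.** If `v` is differentiable
at `x` and `v x ≠ 0`, then `D‖v‖(x) = ⟪e, Dv(x)·⟫` with `e = v(x)/‖v(x)‖` (Fermat: the nonnegative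
function `‖v‖ − ⟪e, v⟫` vanishes at `x`). [folklore] -/
theorem fastSet_fderiv_norm_eq {E F : Type*} [NormedAddCommGroup E] [NormedSpace ℝ E]
    [NormedAddCommGroup F] [InnerProductSpace ℝ F] {v : E → F} {x : E}
    (hv : DifferentiableAt ℝ v x) (hx : v x ≠ 0) :
    fderiv ℝ (fun y => ‖v y‖) x = (innerSL ℝ (‖v x‖⁻¹ • v x)).comp (fderiv ℝ v x) := by
  set e : F := ‖v x‖⁻¹ • v x with he
  have hvx : 0 < ‖v x‖ := norm_pos_iff.2 hx
  have hen : ‖e‖ = 1 := by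
    rw [he, norm_smul, norm_inv, norm_norm, inv_mul_cancel₀ hvx.ne']
  have hex : ⟪e, v x⟫ = ‖v x‖ := by
    rw [he, real_inner_smul_left, real_inner_self_eq_norm_sq]
    field_simp
  have hmin : IsLocalMin (fun y => ‖v y‖ - ⟪e, v y⟫) x := by
    refine Filter.Eventually.of_forall fun y => ?_
    show ‖v x‖ - ⟪e, v x⟫ ≤ ‖v y‖ - ⟪e, v y⟫
    rw [hex, sub_self, sub_nonneg]
    calc ⟪e, v y⟫ ≤ ‖e‖ * ‖v y‖ := real_inner_le_norm _ _
      _ = ‖v y‖ := by rw [hen, one_mul]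
  have hd1 : DifferentiableAt ℝ (fun y => ‖v y‖) x := hv.norm ℝ hx
  have h3 : HasFDerivAt (fun y => ⟪e, v y⟫) ((innerSL ℝ e).comp (fderiv ℝ v x)) x := by
    have := (innerSL ℝ e).hasFDerivAt.comp x hv.hasFDerivAt
    simpa [Function.comp_def] using this
  have h0 := hmin.fderiv_eq_zero
  rw [fderiv_fun_sub hd1 h3.differentiableAt, sub_eq_zero] at h0
  rw [h0, h3.fderiv]

/-- **Caloric extension of an affine functional of the data**: for bounded continuous `v`,
`e^{τΔ}(c − ⟪e, v⟫) = c − ⟪e, e^{τΔ}v⟫` (mass one, linearity of the Bochner integral). [folklore] -/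
theorem heatExtension_const_sub_inner {E : Type*} [NormedAddCommGroup E] [InnerProductSpace ℝ E]
    [FiniteDimensional ℝ E] [MeasurableSpace E] [BorelSpace E] {v : E → E} (hv : Continuous v)
    {C : ℝ} (hC : ∀ z, ‖v z‖ ≤ C) (c : ℝ) (e : E) {τ : ℝ} (hτ : 0 < τ) (z : E) :
    heatExtension (fun y => c - ⟪e, v y⟫) τ z = c - ⟪e, heatExtension v τ z⟫ := by
  rw [heatExtension_apply, heatExtension_apply]
  have hK := integrable_heatKernel_holds (E := E) hτ
  have iv : Integrable fun y => heatKernel τ y • v (z - y) :=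
    integrable_heatKernel_smul_of_bound hv hC hτ z
  have h1 : (fun y => heatKernel τ y • (c - ⟪e, v (z - y)⟫)) =
      fun y => heatKernel τ y * c - ⟪e, heatKernel τ y • v (z - y)⟫ := by
    funext y; rw [smul_eq_mul, mul_sub, real_inner_smul_right]
  rw [h1, integral_sub (hK.mul_const c) (iv.const_inner e), integral_mul_const,
    integral_heatKernel_eq_one_holds hτ, one_mul]
  congr 1
  exact integral_inner iv e

/-! ### The gradient of the Duhamel term in the early window (unit form) -/

/-- **Bounded gradient of the Duhamel term from `s = t/2`** (`ν = 1`, speed `≤ 1`): there is an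
absolute `P ≥ 0` such that for every classical solution of the unforced Navier–Stokes system on
`ℝ³ × (0, b)` with `‖u‖ ≤ 1` on `(0, T] × ℝ³` (`T < b`) and `‖u(t)‖_{L²} ≤ K < ∞` there, and all
`t ∈ (0, T)` with `t ≤ 1`, the Duhamel term `y ↦ B_{t/2}(u,u)(t)(y)` is differentiable with
`‖D B_{t/2}(u,u)(t)(x)‖ ≤ P` at every `x`: the derivative falls on the data
(`fderiv_oseenSlice_apply_of_contDiff`), `‖D N_{t-σ}[u(σ),u(σ)]‖ ≤ 2C₀ (t−σ)^{-1/2} ‖∇u(σ)‖_∞`,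
and the early rate `‖∇u(σ)‖ ≤ C/√σ ≤ C√2/√t` on `(t/2, t)` (`earlyBookkeeping_norm_fderiv_le_unit`)
integrates to `2C₀ · C√(2/t) · 2√(t/2) = 4 C₀ C`. [folklore] -/
theorem levelSetModeration_norm_fderiv_oseenDuhamel_le_unit :
    ∃ P : ℝ, 0 ≤ P ∧ ∀ {b T : ℝ} {u : ℝ → EuclideanSpace ℝ (Fin 3) → EuclideanSpace ℝ (Fin 3)} {p : ℝ → EuclideanSpace ℝ (Fin 3) → ℝ}, Literature.Analysis.FluidPDE.IsClassicalNSSolutionOn (Set.Ioo 0 b) 1 0 u p → 0 < T → T < b → (∀ t ∈ Set.Ioc 0 T, ∀ x, ‖u t x‖ ≤ 1) → ∀ {K : ENNReal}, K ≠ ⊤ → (∀ t ∈ Set.Ioc 0 T, MeasureTheory.eLpNorm (u t) 2 MeasureTheory.volume ≤ K) → ∀ t ∈ Set.Ioo 0 T, t ≤ 1 → ∀ x, HasFDerivAt (fun y => Literature.Analysis.FluidPDE.oseenDuhamel 1 (t / 2) u u t y) (fderiv ℝ (fun y => Literature.Analysis.FluidPDE.oseenDuhamel 1 (t / 2) u u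 t y) x) x ∧ ‖fderiv ℝ (fun y => Literature.Analysis.FluidPDE.oseenDuhamel 1 (t / 2) u u t y) x‖ ≤ P := by
  obtain ⟨Cg, hCg0, hG⟩ := earlyBookkeeping_norm_fderiv_le_unit
  obtain ⟨CS, hCS, hS⟩ := exists_norm_oseenSlice_le (E := EuclideanSpace ℝ (Fin 3))
  refine ⟨4 * CS * Cg, by positivity, ?_⟩
  intro b T u p hcl hT hTb hbd K hK hL2 t ht ht1 x
  classical
  set s : ℝ := t / 2 with hs_def
  have hs : 0 < s := by rw [hs_def]; linarith [ht.1]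
  have hst : s < t := by rw [hs_def]; linarith [ht.1]
  have hts : t - s = s := by rw [hs_def]; ring
  -- the cut-off field (jointly measurable)
  set S : Set (ℝ × EuclideanSpace ℝ (Fin 3)) := Ioo 0 T ×ˢ univ with hSdef
  set U : ℝ → EuclideanSpace ℝ (Fin 3) → EuclideanSpace ℝ (Fin 3) :=
    fun τ y => if τ ∈ Ioo 0 T then u τ y else 0 with hU
  have hUeq : ∀ {τ : ℝ}, τ ∈ Ioo 0 T → U τ = u τ := by
    intro τ hτ; funext y; simp only [hU, if_pos hτ]
  have hUunc : uncurry U = S.piecewise (uncurry u) 0 := by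
    funext z
    obtain ⟨τ, y⟩ := z
    by_cases hτ : τ ∈ Ioo 0 T
    · have hz : (τ, y) ∈ S := mk_mem_prod hτ (mem_univ y)
      simp only [uncurry_apply_pair, hU, if_pos hτ, piecewise_eq_of_mem _ _ _ hz]
    · have hz : (τ, y) ∉ S := fun h => hτ (mem_prod.1 h).1
      simp only [uncurry_apply_pair, hU, if_neg hτ, piecewise_eq_of_notMem _ _ _ hz,
        Pi.zero_apply]
  have hmeas : Measurable (uncurry U) := by
    rw [hUunc]
    refine ContinuousOn.measurable_piecewise ?_ continuousOn_const
      (measurableSet_Ioo.prod MeasurableSet.univ)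
    exact hcl.smooth_velocity.continuousOn.mono (prod_mono (Ioo_subset_Ioo_right hTb.le) subset_rfl)
  have hIoo : ∀ {τ : ℝ}, τ ∈ Ioo s t → τ ∈ Ioo 0 T := fun hτ => ⟨hs.trans hτ.1, hτ.2.trans ht.2⟩
  have hIob : ∀ {τ : ℝ}, τ ∈ Ioo s t → τ ∈ Ioo 0 b := fun hτ =>
    ⟨hs.trans hτ.1, (hτ.2.trans ht.2).trans hTb⟩
  -- bounds of the cut-off field on `(s, t)`
  have hU1 : ∀ τ ∈ Ioo s t, ∀ y, ‖U τ y‖ ≤ (fun _ => (1 : ℝ)) τ := by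
    intro τ hτ y
    rw [hUeq (hIoo hτ)]
    exact hbd τ ⟨hs.trans hτ.1, (hτ.2.trans ht.2).le⟩ y
  -- the gradient rate on `(s, t)`: `‖∇u(σ)‖ ≤ Cg/√s`
  set D : ℝ := Cg / Real.sqrt s with hD
  have hsqs : 0 < Real.sqrt s := Real.sqrt_pos.2 hs
  have hD0 : 0 ≤ D := by rw [hD]; positivity
  have hgrad : ∀ τ ∈ Ioo s t, ∀ y, ‖fderiv ℝ (u τ) y‖ ≤ D := by
    intro τ hτ y
    have h1 := hG hcl hT hTb hbd hK hL2 τ ⟨hs.trans hτ.1, hτ.2.trans ht.2⟩ (hτ.2.le.trans ht1) y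
    refine h1.trans ?_
    rw [hD]
    exact div_le_div_of_nonneg_left hCg0 hsqs (Real.sqrt_le_sqrt hτ.1.le)
  -- the slice-level derivative bound
  set bound : ℝ → ℝ := fun τ => 2 * CS * D * (t - τ) ^ (-(1 / 2 : ℝ)) with hbound
  have hb : ∀ τ ∈ Ioo s t, ∀ y,
      ‖fderiv ℝ (oseenSlice (1 * (t - τ)) (U τ) (U τ)) y‖ ≤ bound τ := by
    intro τ hτ y
    have hσ : 0 < t - τ := sub_pos.2 hτ.2
    rw [one_mul, hUeq (hIoo hτ)]
    have hc1 : ContDiff ℝ 1 (u τ) := contDiff_infty.1 (hcl.contDiff_velocity (hIob hτ)) 1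
    have hu1 : ∀ y, ‖u τ y‖ ≤ 1 := fun y => hbd τ ⟨hs.trans hτ.1, (hτ.2.trans ht.2).le⟩ y
    have hDu : ∀ y, ‖fderiv ℝ (u τ) y‖ ≤ D := hgrad τ hτ
    have hnn : 0 ≤ bound τ := by
      simp only [hbound]
      exact mul_nonneg (by positivity) (Real.rpow_nonneg hσ.le _)
    refine ContinuousLinearMap.opNorm_le_bound _ hnn fun h => ?_
    rw [fderiv_oseenSlice_apply_of_contDiff hσ hc1 hc1 hu1 hu1 hDu hDu y h]
    have ha : ∀ z, ‖fderiv ℝ (u τ) z h‖ ≤ D * ‖h‖ := fun z =>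
      (ContinuousLinearMap.le_opNorm _ _).trans (mul_le_mul_of_nonneg_right (hDu z) (norm_nonneg _))
    have h1 := hS hσ (a := fun z => fderiv ℝ (u τ) z h) (b := u τ) ha hu1 y
    have h2 := hS hσ (a := u τ) (b := fun z => fderiv ℝ (u τ) z h) hu1 ha y
    calc ‖oseenSlice (t - τ) (fun z => fderiv ℝ (u τ) z h) (u τ) y +
          oseenSlice (t - τ) (u τ) (fun z => fderiv ℝ (u τ) z h) y‖
        ≤ CS * (t - τ) ^ (-(1 / 2 : ℝ)) * (D * ‖h‖) * 1 +
          CS * (t - τ) ^ (-(1 / 2 : ℝ)) * 1 * (D * ‖h‖) :=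
          (norm_add_le _ _).trans (add_le_add h1 h2)
      _ = bound τ * ‖h‖ := by simp only [hbound]; ring
  -- integrability of the weights
  have hIi : IntervalIntegrable (fun τ => (t - τ) ^ (-(1 / 2 : ℝ))) volume s t := by
    have := (intervalIntegral.intervalIntegrable_rpow' (a := t - s) (b := 0)
      (by norm_num : (-1 : ℝ) < -(1 / 2 : ℝ))).comp_sub_left t
    simpa using this
  have hIoo_int : IntegrableOn (fun τ => (t - τ) ^ (-(1 / 2 : ℝ))) (Ioo s t) volume :=
    (hIi.1).mono_set Ioo_subset_Ioc_self
  have hdom : IntegrableOn (fun τ => (t - τ) ^ (-(1 / 2 : ℝ)) *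
      ((fun _ => (1 : ℝ)) τ * (fun _ => (1 : ℝ)) τ)) (Ioo s t) volume := by
    refine hIoo_int.congr_fun (fun τ _ => ?_) measurableSet_Ioo
    simp only [mul_one]
  have hbi : IntegrableOn bound (Ioo s t) volume := by
    rw [hbound]
    exact hIoo_int.const_mul (2 * CS * D)
  -- the Duhamel terms of `U` and `u` agree
  have hcongr : (fun y => oseenDuhamel 1 s U U t y) = fun y => oseenDuhamel 1 s u u t y := by
    funext y
    exact LongLivedOseenSolution.oseenDuhamel_congr (fun τ hτ => hUeq (hIoo hτ))
      (fun τ hτ => hUeq (hIoo hτ)) y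
  have hderU := hasFDerivAt_oseenDuhamel hmeas hmeas hU1 hU1 hdom hb hbi x
  have hnormU := norm_fderiv_oseenDuhamel_le hmeas hmeas hU1 hU1 hdom hb hbi x
  rw [hcongr] at hderU hnormU
  refine ⟨?_, hnormU.trans ?_⟩
  · rw [hderU.fderiv]; exact hderU
  -- `∫_{(s,t)} bound = 2 CS D · 2√(t - s) = 4 CS Cg`
  have hval : ∫ τ in Ioo s t, (t - τ) ^ (-(1 / 2 : ℝ)) = 2 * Real.sqrt (t - s) := by
    rw [← integral_Ioc_eq_integral_Ioo, ← intervalIntegral.integral_of_le hst.le,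
      integral_rpow_sub_left_eq (by norm_num : (-1 : ℝ) < -(1 / 2 : ℝ)),
      show -(1 / 2 : ℝ) + 1 = 1 / 2 by norm_num, ← Real.sqrt_eq_rpow]
    ring
  have hI : ∫ τ in Ioo s t, bound τ = 4 * CS * Cg := by
    rw [hbound, integral_const_mul, hval, hts, hD]
    field_simp
    ring
  rw [hI]

end Summit.NavierStokesRegularity.NavierStokesRegularity.Theorems

end
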